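import Summits.AtomisticToContinuum.HydrodynamicLimit.Theorems.EnskogAdjointDualityCollisionResidualVanishesCutCloses
import Summits.AtomisticToContinuum.HydrodynamicLimit.Theorems.EnskogAdjointDualityCollisionResidualVanishesCutDecides
import Summits.AtomisticToContinuum.HydrodynamicLimit.Theorems.EnskogAdjointDualityCollisionResidualVanishesConjunctGrade
import Summits.AtomisticToContinuum.HydrodynamicLimit.Theorems.EnskogAdjointDualityDualityReductionEosWindow

/-!
# Line `birth` — crux `EnskogAdjointDuality.CollisionResidualVanishes` (stmt-AtomisticToContinuum-14658)

SKELETON v6 (line lead c7, cycle 7, 2026-08-17) = v5 (lead c6) + the exactness certificate modulo the REPAIRED sibling crux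
K2R′ (`Theorems.AdjointEnskogTestFamilyRCut`, cutoff repair R1; `stub₁_of_collisionResidualVanishes_of_testFamilyRCut`,
`stubs_iff_collisionResidualVanishes_of_testFamilyRCut` below, from the landed `Theorems.closes_cut` package) — stubs and composition
UNCHANGED. History: v1 = the birth bias/variance split
`stub_selfAveraging ∧ stub_meanDefectVanishes` (sha 5c0aa23d…; both open-problem grade — leads -0/c2/c3, `CYCLE3.md`);
v2/v3 (lead c4, sha e6e85ead…) = `stub_dualResidual ∧ stub_nondualExtension` with `stub_dualResidual :=
Theorems.CollisionResidualVanishesDual` (K1 on K2R's approximately-dual families), certified conjunct-equivalent GIVEN the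
sibling crux K2R; v4 (lead c5, sha fcc5f7c8…) = `stub_hydroLimitAllWindows ∧ stub_nondualExtension`, composition
`h₂ (dual_of_forall_hydroLimitInBandAt h₁)`. WHY v5: on 2026-08-17 K2R (`AdjointEnskogTestFamilyR`, stmt-11592) was REFUTED AS
TYPED by its line lead (`Cruxes/AdjointEnskogTestFamilyR/HyperVelocityObstruction.md`): its property (iii), the defect bound
`|Dφ^N + L^Nφ^N| ≤ η_N(1+|v|²)` for ALL `v ∈ ℝ³`, is unsatisfiable in the admissible class (isotropic log cascade at
hyper-velocities `|v| ≍ λ_N e^{O(λ_N)}`). Hence the ∀`v`-dual families of v3/v4's `DualResidual` do not exist at any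
non-trivial datum, `DualResidual` is vacuous in substance, and v4's `stub_nondualExtension : DualResidual → K1` was K1 itself.
v5 replaces the dual class by the CUTOFF-dual class of the proposed repair (R1: (iii) only for `‖v‖ ≤ N+1`, plus a global
polynomial defect bound), for which lead c6 re-proved the converse duality theorem K2R-FREE
(`Theorems.dualCut_of_forall_hydroLimitInBandAt`, via the cutoff toolkit `…CutoffPathwise/Moments/FSide/Assembly/Converse.lean`):

* `stub_hydroLimitAllWindows` (unchanged) — **THE PACKING-GUARDED HYDRODYNAMIC LIMIT AT EVERY EOS WINDOW**
  (`HydroLimitAllWindows`: for every `η₁ > 0` with `f_ex` analytic, `f_ex′ > 0`, `(ηZ)′ > 0` on `(0,η₁)`, the Statement's body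
  `HydroLimitInBandAt η₁`). Implies `_root_.HydrodynamicLimit` (`summit_of_stub_hydroLimitAllWindows`) and, K2R-free, K1 on
  the cutoff-dual families (`dualCutResidual_of_stub_hydroLimitAllWindows`). Conjunct-or-harder.
* `stub_nondualCutExtension` — **THE OVER-STRENGTH RESIDUE** (`NondualCutExtension := DualCutResidual → K1`): extending the
  mean-square vanishing of `𝓡_N` from the cutoff-dual families to ALL admissible families (time-averaged weak local
  equilibrium for the non-conserved observables `(D + L^N_s)φ^N_s`, collisional-transfer / kinetic-flux LLN, time-irregular
  families — local-equilibrium grade, consumed by no assembly; `CYCLE5.md` §3, `CYCLE6.md`).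

Composition `CollisionResidualVanishes_of` (PROVED, K2R-free): `h₂ (Theorems.dualCut_of_forall_hydroLimitInBandAt h₁)`.
Exactness: K1 ⟹ STUB 2 trivially and K1 ⟹ `DualCutResidual` (`Theorems.dualCut_of_collisionResidualVanishes`); K1 ⟹ STUB 1
needs the REPAIRED sibling crux K2R′ (the cutoff assembly `Theorems.residual_assembly_cut`'s forward twin; to be filed by the
planner) — recorded, not claimed. RECOMMENDATION (planner): restate K2R := K2R′ (R1) and K1 := `Theorems.CollisionResidualVanishesDualCut`
JOINTLY (deciding theorem = `closes` re-proved with `pathwise_duality_bound_cut` + the energy split of `residual_assembly_cut`);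
do NOT restate K1 to the cycle-4 `Theorems.CollisionResidualVanishesDual` (void premise). See `CYCLE6.md`.

Disproof used: none on file for this crux (`ledger crux ls stmt-AtomisticToContinuum-14658`, 2026-08-17T14:0xZ: no
`Disproof.lean`, no Negative lemmas); used from the sibling crux: `HyperVelocityObstruction.md` §§0, 6, 9.
-/

open MeasureTheory Filter Set Topology

namespace Summit.AtomisticToContinuum.HydrodynamicLimit.Cruxes.CollisionResidualVanishes.Birth

open Summit.AtomisticToContinuum.HydrodynamicLimit.Theses.EnskogAdjointDuality
  (CollisionResidualVanishes)

/-! ## § 1 The stub statements -/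

/-- **STUB 1 statement (v4/v5): the packing-guarded conjunct at every EOS window** — for every `η₁ > 0` on which
`hsExcessFreeEnergy` is analytic with `f_ex′ > 0` and `(ηZ)′ > 0` (the EOS-window prefix of the route decl verbatim), the
body `Theorems.HydroLimitInBandAt η₁` of the Statement decl `_root_.HydrodynamicLimit` (`Theorems.hydrodynamicLimit_iff_exists_inBandAt`). -/
abbrev HydroLimitAllWindows : Prop :=
  ∀ η₁ : ℝ, 0 < η₁ →
    AnalyticOnNhd ℝ Literature.MathematicalPhysics.KineticTheory.hsExcessFreeEnergy (Set.Ioo 0 η₁) →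
    (∀ η ∈ Set.Ioo 0 η₁, 0 < deriv Literature.MathematicalPhysics.KineticTheory.hsExcessFreeEnergy η) →
    (∀ η ∈ Set.Ioo 0 η₁, 0 < deriv (fun x : ℝ =>
      x * Literature.MathematicalPhysics.KineticTheory.hsCompressibility x) η) →
    Summit.AtomisticToContinuum.HydrodynamicLimit.Theorems.HydroLimitInBandAt η₁

/-- K1 restricted to the CUTOFF-dual families (the landed `Theorems.CollisionResidualVanishesDualCut`, cycle 6): the
restatement candidate for K1 after the K2R refutation — a definition, not a stub. -/
abbrev DualCutResidual : Prop :=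
  Summit.AtomisticToContinuum.HydrodynamicLimit.Theorems.CollisionResidualVanishesDualCut

/-- **STUB 2 statement (v5): the over-strength residue** — K1 on the cutoff-dual families implies K1 on ALL admissible
families. -/
def NondualCutExtension : Prop :=
  DualCutResidual → CollisionResidualVanishes

/-! ## § 2 Registered stubs (`sorry` only here) -/

/-- STUB 1 (v4/v5; conjunct-or-harder; HARDEST — it is the packing-guarded hydrodynamic limit itself, at every EOS window). -/
theorem stub_hydroLimitAllWindows : HydroLimitAllWindows := by
  sorry

/-- STUB 2 (v5; open, beyond the conjunct; the part of K1 a restatement to the cutoff-dual families drops). -/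
theorem stub_nondualCutExtension : NondualCutExtension := by
  sorry

/-! ### Name-keyed aliases of the stub statements (the hypotheses of the composition) -/
namespace Registered

/-- Alias of `HydroLimitAllWindows` keyed by the registered stub name. -/
abbrev stub_hydroLimitAllWindows : Prop := HydroLimitAllWindows
/-- Alias of `NondualCutExtension` keyed by the registered stub name. -/
abbrev stub_nondualCutExtension : Prop := NondualCutExtension

end Registered

/-! ## § 3 Glue (PROVED, by name on the landed theorems) -/

/-- **STUB 1 is at least the sub-problem conjunct**: `HydroLimitAllWindows → _root_.HydrodynamicLimit` (take the EOS window
of the proved support `HsEosLowDensity`, `Theorems.eos_window`; in Theorems as `hydrodynamicLimit_of_forall_hydroLimitInBandAt`). -/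
theorem summit_of_stub_hydroLimitAllWindows (h₁ : Registered.stub_hydroLimitAllWindows) : _root_.HydrodynamicLimit :=
  Summit.AtomisticToContinuum.HydrodynamicLimit.Theorems.hydrodynamicLimit_of_forall_hydroLimitInBandAt h₁

/-- **STUB 1 gives K1 on the cutoff-dual families, K2R-free** (`Theorems.dualCut_of_forall_hydroLimitInBandAt`, i.e. the
cutoff converse duality theorem window by window). -/
theorem dualCutResidual_of_stub_hydroLimitAllWindows (h₁ : Registered.stub_hydroLimitAllWindows) : DualCutResidual :=
  Summit.AtomisticToContinuum.HydrodynamicLimit.Theorems.dualCut_of_forall_hydroLimitInBandAt h₁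

/-- **Half of exactness, K2R-free**: K1 as typed implies `DualCutResidual` (`Theorems.dualCut_of_collisionResidualVanishes`)
and STUB 2 (trivially). (K1 ⟹ STUB 1 needs the repaired sibling crux K2R′ — not claimed here.) -/
theorem dualCut_and_stub₂_of_collisionResidualVanishes (h : CollisionResidualVanishes) :
    DualCutResidual ∧ Registered.stub_nondualCutExtension :=
  ⟨Summit.AtomisticToContinuum.HydrodynamicLimit.Theorems.dualCut_of_collisionResidualVanishes h, fun _ => h⟩

/-- **The other half of exactness, modulo the REPAIRED sibling crux K2R′** (v6, lead c7): given
`Theorems.AdjointEnskogTestFamilyRCut` (cutoff repair R1 of the refuted-as-typed `AdjointEnskogTestFamilyR`), K1 as typed implies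
STUB 1 — K1 ⟹ K1′ (`dualCut_of_collisionResidualVanishes`) ⟹ the conjunct body at every EOS window
(`Theorems.dualCut_iff_forall_hydroLimitInBandAt_of_testFamilyRCut`, whose forward half is the repaired deciding theorem
`Theorems.closes_cut` window by window). -/
theorem stub₁_of_collisionResidualVanishes_of_testFamilyRCut
    (h₂ : Summit.AtomisticToContinuum.HydrodynamicLimit.Theorems.AdjointEnskogTestFamilyRCut)
    (h : CollisionResidualVanishes) : Registered.stub_hydroLimitAllWindows :=
  (Summit.AtomisticToContinuum.HydrodynamicLimit.Theorems.dualCut_iff_forall_hydroLimitInBandAt_of_testFamilyRCut h₂).1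
    (Summit.AtomisticToContinuum.HydrodynamicLimit.Theorems.dualCut_of_collisionResidualVanishes h)

/-- **Exactness of the v5/v6 anatomy modulo K2R′**: given the repaired sibling crux, K1 ⟺ STUB 1 ∧ STUB 2 — the skeleton loses
nothing and STUB 1 (the conjunct at every EOS window) is then EQUIVALENT to K1′ = `DualCutResidual`. -/
theorem stubs_iff_collisionResidualVanishes_of_testFamilyRCut
    (h₂ : Summit.AtomisticToContinuum.HydrodynamicLimit.Theorems.AdjointEnskogTestFamilyRCut) :
    (Registered.stub_hydroLimitAllWindows ∧ Registered.stub_nondualCutExtension) ↔ CollisionResidualVanishes :=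
  ⟨fun h => h.2 (Summit.AtomisticToContinuum.HydrodynamicLimit.Theorems.dualCut_of_forall_hydroLimitInBandAt h.1),
    fun h => ⟨stub₁_of_collisionResidualVanishes_of_testFamilyRCut h₂ h, fun _ => h⟩⟩

/-! ## § 4 Composition: the two registered stubs imply the crux, BY NAME on the route decl (K2R-free) -/

/-- **The line concludes the crux BY NAME**: the conjunct at every EOS window + the non-dual (cutoff) extension give
`Summit.AtomisticToContinuum.HydrodynamicLimit.Theses.EnskogAdjointDuality.CollisionResidualVanishes` (no `sorry`, no K2R). -/
theorem CollisionResidualVanishes_of (h₁ : Registered.stub_hydroLimitAllWindows)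
    (h₂ : Registered.stub_nondualCutExtension) :
    Summit.AtomisticToContinuum.HydrodynamicLimit.Theses.EnskogAdjointDuality.CollisionResidualVanishes :=
  h₂ (Summit.AtomisticToContinuum.HydrodynamicLimit.Theorems.dualCut_of_forall_hydroLimitInBandAt h₁)

/-- Wiring check: the registered stubs feed `CollisionResidualVanishes_of` as stated. -/
example : Summit.AtomisticToContinuum.HydrodynamicLimit.Theses.EnskogAdjointDuality.CollisionResidualVanishes :=
  CollisionResidualVanishes_of stub_hydroLimitAllWindows stub_nondualCutExtension

end Summit.AtomisticToContinuum.HydrodynamicLimit.Cruxes.CollisionResidualVanishes.Birth
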